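import Literature.Computability.Cryptography.ClassBQP
import Literature.Computability.QuantumComplexity.CWrapAssembly
import Literature.Computability.QuantumComplexity.BPPRelSubsetBQPRel
import Literature.Computability.QuantumComplexity.OracleSubstitution
import HarnessLib

/-!
# `PromiseBQP` and `BQP` are closed under complement (discharge of `swap_mem_PromiseBQP`, `co_BQP`)

Second sibling proof file of `ClassBQP.lean` (theorems only; the named facts stay `def`s there,
D-0014). It discharges

* `Literature.Computability.Cryptography.swap_mem_PromiseBQP` — if `Q ∈ PromiseBQP` then the
  promise problem with yes- and no-instances exchanged is in `PromiseBQP`;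
* and, as corollaries through `ofLanguage_mem_PromiseBQP_iff` and
  `PromiseProblem.swap_ofLanguage`, the pointwise and class forms for languages
  `Literature.Computability.Cryptography.compl_mem_BQP_iff` (`Lᶜ ∈ BQP ↔ L ∈ BQP`) and
  `Literature.Computability.Cryptography.co_BQP` (`co BQP = BQP`).

## Source and proof

J. Watrous, *Quantum computational complexity*, Encyclopedia of Complexity and Systems Science
(Springer 2009) = arXiv:0804.3401, §IV.1 (arXiv §4.1): `BQP(a, b)` is *defined* as a class of
promise problems `A = (A_yes, A_no)` — a polynomial-time generated family `{Q_n}` accepts every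
`x ∈ A_yes` with probability `≥ a(|x|)` and every `x ∈ A_no` with probability `≤ b(|x|)`, and
`BQP = BQP(2/3, 1/3)`; this is the tree's `PromiseBQP` (uniform Clifford+T families, wire `0`
measured). Closure under exchanging yes- and no-instances is the standard one-line remark that
the measured output bit may be negated — a classical post-processing step, and classical
polynomial-time computation is free inside polynomial-time generated quantum circuit families
(Watrous §IV.3, "Simulating classical computations with quantum circuits"; Bernstein–Vazirani
1997, §8). The proof here is literally that, on top of the tree's discharged closure of
bounded-error quantum search under `FP` pre- and post-processing
(`isQSolvable_classicalWrap_holds`, `QuantumComplexity/CWrapAssembly.lean`):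

1. the given family `F` solves, with probability `≥ 2/3` on *every* input, the search problem
   `R x = {y | (x ∈ Q.yes → y₀ = 1) ∧ (x ∈ Q.no → y₀ ≠ 1)}` (on the promise this is the
   acceptance condition read off the kernel, `kernelProb_prefix_true_eq_acceptProbOn` and the
   complement rule `QCircuitFamily.kernelProb_add_kernelProb_compl`; off the promise `R x` is
   everything);
2. wrapping `F` with the identity pre-processor and the `FP` post-processor
   `⟨x, y⟩ ↦ [¬ y₀]` (`Brick.notFn (HashBricks.headBitFn ∘ Brick.sndF)`) gives a uniform
   oracle-free family writing `[¬ y₀]`, `y ∈ R x`, on wire `0` with probability `≥ 2/3`;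
3. hence on `x ∈ Q.no` it accepts with probability `≥ 2/3`, and on `x ∈ Q.yes` it writes `0`
   first with probability `≥ 2/3`, so accepts with probability `≤ 1/3`
   (`kernelProb_add_kernelProb_le_one`).

## References

* J. Watrous, *Quantum computational complexity*, in: Encyclopedia of Complexity and Systems
  Science, Springer 2009, doi:10.1007/978-0-387-30440-3_428 (= arXiv:0804.3401), §IV.1
  (Definition of `BQP(a,b)` for promise problems), §IV.3 (classical computations inside quantum
  circuits), §IV.4 Cor. 5 (`BQP^BQP = BQP`) [Watrous2009].
* E. Bernstein, U. Vazirani, *Quantum complexity theory*, SIAM J. Comput. 26 (1997), §8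
  [BernsteinVazirani1997].
* O. Goldreich, *On promise problems: a survey*, LNCS 3895 (2006), §1.1 (complement of a promise
  problem) [Goldreich2006].
-/

namespace Literature.Computability.Cryptography

open _root_.Computability Complexity QuantumComplexity Complexity.Brick Complexity.HashBricks

/-! ### Kernel bookkeeping -/

section kernel

variable {G : QGateSet}

/-- **Complement rule for the output kernel**: for every event `E`, the probabilities that the
measured output string of a family lies in `E` and in `Eᶜ` add up to `1` (the kernel is a
probability distribution). [folklore] -/
theorem QCircuitFamily.kernelProb_add_kernelProb_compl (F : QCircuitFamily G) (A : Language Bool)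
    (x : List Bool) (E : Set (List Bool)) :
    F.kernelProb A x E + F.kernelProb A x Eᶜ = 1 := by
  classical
  unfold QCircuitFamily.kernelProb
  set q := F.kernel A x
  have hfin : ∀ S : Set (List Bool), q.toOuterMeasure S ≠ ⊤ := fun S =>
    ne_top_of_le_ne_top ENNReal.one_ne_top ((q.toOuterMeasure.mono (Set.subset_univ S)).trans
      ((PMF.toOuterMeasure_apply_eq_one_iff q Set.univ).2 (Set.subset_univ _)).le)
  rw [← ENNReal.toReal_add (hfin E) (hfin Eᶜ), PMF.toOuterMeasure_apply, PMF.toOuterMeasure_apply,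
    ← ENNReal.tsum_add]
  have h : (fun a => E.indicator (⇑q) a + Eᶜ.indicator (⇑q) a) = ⇑q := by
    funext a
    exact Set.indicator_self_add_compl_apply E (⇑q) a
  rw [h, q.tsum_coe, ENNReal.toReal_one]

/-- The sure event has kernel probability `1`. [folklore] -/
theorem QCircuitFamily.kernelProb_univ_eq_one (F : QCircuitFamily G) (A : Language Bool)
    (x : List Bool) : F.kernelProb A x Set.univ = 1 := by
  unfold QCircuitFamily.kernelProb
  rw [((F.kernel A x).toOuterMeasure_apply_eq_one_iff Set.univ).2 (Set.subset_univ _),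
    ENNReal.toReal_one]

end kernel

/-! ### The negating post-processor -/

/-- A string that does not start with `true` has head bit `false` (default `false` on `ε`).
[folklore] -/
theorem headD_false_eq_false_of_not_prefix {y : List Bool} (h : ¬ [true] <+: y) :
    y.headD false = false := by
  cases y with
  | nil => rfl
  | cons b t =>
    cases b with
    | false => rfl
    | true => exact absurd ((List.singleton_prefix_cons_iff).2 rfl) h

/-- A string that starts with `true` has head bit `true`. [folklore] -/
theorem headD_false_eq_true_of_prefix {y : List Bool} (h : [true] <+: y) : y.headD false = true := by
  cases y with
  | nil => simp at h
  | cons b t => exact ((List.singleton_prefix_cons_iff).1 h).symm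

/-- **The post-processor `⟨x, y⟩ ↦ [¬ y₀]`** (unpair, read the head bit of the second component,
negate), assembled from the tree's `FP` bricks, evaluated on a pair. [folklore] -/
theorem notFn_headBitFn_sndF_boolPair (x y : List Bool) :
    notFn (headBitFn ∘ sndF) (boolPair x y) = [!(y.headD false)] :=
  notFn_apply (by rw [Function.comp_apply, sndF_boolPair, headBitFn_apply])

/-- The post-processor `⟨x, y⟩ ↦ [¬ y₀]` is polynomial-time computable. [folklore] -/
theorem notFn_headBitFn_sndF_mem_FP : notFn (headBitFn ∘ sndF) ∈ FP :=
  notFn_mem_FP (comp_mem_FP headBitFn_mem_FP sndF_mem_FP)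

/-! ### Closure of `PromiseBQP` under complement -/

/-- **`PromiseBQP` is closed under exchanging yes- and no-instances** — discharge of the named
fact `swap_mem_PromiseBQP`. Watrous defines `BQP = BQP(2/3, 1/3)` as a class of promise problems
(§IV.1); the complement is decided by the same polynomial-time generated family with its output
bit negated, a classical post-processing step (§IV.3). Formally: the given family solves the
search problem "first output bit `= [x ∈ Q.yes]` on the promise" with probability `≥ 2/3`; wrap
it (`isQSolvable_classicalWrap_holds`) with the `FP` post-processor `⟨x, y⟩ ↦ [¬ y₀]`; the
wrapped uniform oracle-free family accepts `x ∈ Q.no` with probability `≥ 2/3` and `x ∈ Q.yes`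
with probability `≤ 1/3`. [cite: Watrous2009, §IV.1 (Definition of BQP(a,b) for promise problems) and §IV.3] -/
theorem swap_mem_PromiseBQP_holds : swap_mem_PromiseBQP := by
  intro Q hQ
  obtain ⟨F, hfree, hunif, hyes, hno⟩ := hQ
  -- the search problem solved by `F` on every input
  set R : List Bool → Set (List Bool) :=
    fun x => {y | (x ∈ Q.yes → [true] <+: y) ∧ (x ∈ Q.no → ¬ [true] <+: y)} with hR
  have hsolv : IsQSolvable R := by
    refine ⟨F, hfree, hunif, fun x => ?_⟩
    by_cases hy : x ∈ Q.yes
    · by_cases hn : x ∈ Q.no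
      · have h1 := hyes x hy
        have h2 := hno x hn
        exfalso
        linarith
      · have hRx : R x = {y | [true] <+: y} := by
          ext y
          simp [hR, hy, hn]
        rw [hRx, kernelProb_prefix_true_eq_acceptProbOn]
        exact hyes x hy
    · by_cases hn : x ∈ Q.no
      · have hRx : R x = {y | [true] <+: y}ᶜ := by
          ext y
          simp [hR, hy, hn]
        have h1 := F.kernelProb_add_kernelProb_compl 0 x {y | [true] <+: y}
        rw [kernelProb_prefix_true_eq_acceptProbOn] at h1
        have h2 := hno x hn
        rw [hRx]
        linarith
      · have hRx : R x = Set.univ := by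
          ext y
          simp [hR, hy, hn]
        rw [hRx, F.kernelProb_univ_eq_one]
        norm_num
  -- wrap with the identity pre-processor and the negating post-processor
  obtain ⟨F', hfree', hunif', hF'⟩ := isQSolvable_classicalWrap_holds id (notFn (headBitFn ∘ sndF))
    (PolyTimeComputable.id _) notFn_headBitFn_sndF_mem_FP hsolv
  have hF'x : ∀ x, 2 / 3 ≤
      F'.kernelProb 0 x {z | ∃ y ∈ R x, notFn (headBitFn ∘ sndF) (boolPair x y) <+: z} :=
    fun x => hF' x
  refine ⟨F', hfree', hunif', fun x hx => ?_, fun x hx => ?_⟩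
  · -- `x ∈ Q.no`: the wrapped family writes `true` first with probability `≥ 2/3`
    have hx' : x ∈ Q.no := hx
    have hsub : {z | ∃ y ∈ R x, notFn (headBitFn ∘ sndF) (boolPair x y) <+: z} ⊆
        {z | [true] <+: z} := by
      rintro z ⟨y, hy, hz⟩
      rw [notFn_headBitFn_sndF_boolPair, headD_false_eq_false_of_not_prefix (hy.2 hx')] at hz
      exact hz
    rw [← kernelProb_prefix_true_eq_acceptProbOn]
    exact (hF'x x).trans (F'.kernelProb_mono 0 x hsub)
  · -- `x ∈ Q.yes`: the wrapped family writes `false` first with probability `≥ 2/3`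
    have hx' : x ∈ Q.yes := hx
    have hsub : {z | ∃ y ∈ R x, notFn (headBitFn ∘ sndF) (boolPair x y) <+: z} ⊆
        {z | [false] <+: z} := by
      rintro z ⟨y, hy, hz⟩
      rw [notFn_headBitFn_sndF_boolPair, headD_false_eq_true_of_prefix (hy.1 hx')] at hz
      exact hz
    have h1 := (hF'x x).trans (F'.kernelProb_mono 0 x hsub)
    have h2 := kernelProb_add_kernelProb_le_one F' 0 x disjoint_prefix_true_false
    rw [kernelProb_prefix_true_eq_acceptProbOn] at h2
    linarith

/-! ### Corollaries for languages: `Lᶜ ∈ BQP ↔ L ∈ BQP`, `co BQP = BQP` -/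

/-- **`L ∈ BQP` iff `Lᶜ ∈ BQP`** — discharge of the named fact `compl_mem_BQP_iff`: a language
is in `BQP` iff its promise problem with trivial promise is in `PromiseBQP`
(`ofLanguage_mem_PromiseBQP_iff`), the promise problem of `Lᶜ` is the swap of that of `L`
(`PromiseProblem.swap_ofLanguage`), and `PromiseBQP` is closed under swapping
(`swap_mem_PromiseBQP_holds`). [cite: Watrous2009, §IV.1 and §IV.3] -/
theorem compl_mem_BQP_iff_holds : compl_mem_BQP_iff := by
  intro L
  constructor
  · intro h
    have h1 : (PromiseProblem.ofLanguage L).swap ∈ PromiseBQP := by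
      rw [PromiseProblem.swap_ofLanguage]
      exact ofLanguage_mem_PromiseBQP_iff.2 h
    have h2 : (PromiseProblem.ofLanguage L).swap.swap ∈ PromiseBQP := swap_mem_PromiseBQP_holds h1
    rw [PromiseProblem.swap_swap] at h2
    exact ofLanguage_mem_PromiseBQP_iff.1 h2
  · intro h
    have h1 : (PromiseProblem.ofLanguage L).swap ∈ PromiseBQP :=
      swap_mem_PromiseBQP_holds (ofLanguage_mem_PromiseBQP_iff.2 h)
    rw [PromiseProblem.swap_ofLanguage] at h1
    exact ofLanguage_mem_PromiseBQP_iff.1 h1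

/-- **`co BQP = BQP`** — discharge of the named fact `co_BQP` (`BQP` is closed under complement:
negate the output bit), the class form of `compl_mem_BQP_iff_holds`.
[cite: Watrous2009, §IV.1 and §IV.3] -/
theorem co_BQP_holds : co_BQP :=
  Set.ext fun _ => compl_mem_BQP_iff_holds

end Literature.Computability.Cryptography
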